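import Summits.KontsevichZagierPeriods.KontsevichZagierPeriods.Theses.SpectrahedralScissors

/-!
# Crux `RebitCore2964` — birth skeleton (line `birth`)
# Lovas–Andai's proof of `P_sep(ℝ) = 29/64` as a chain of moves, cut at its three changes of scenery

Crux (route `SpectrahedralScissors`, item `stmt-KontsevichZagierPeriods-9265`, rank 3; decl
`Summit.KontsevichZagierPeriods.KontsevichZagierPeriods.Theses.SpectrahedralScissors.RebitCore2964`):
`[Core_ℝ, 64] ~ [K_ℝ, 29]` in the KZ calculus (`KZ.Equivalent`), where
`K_ℝ = {x ∈ ℝ⁷ | ρ(x) ≽ 0}`, `ρ(x) = [[X, Z], [Zᵀ, ½ − X]]`, `X = [[x0, x2], [x2, x1]]`,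
`Z = [[x3, x4], [x5, x6]]`, is the spectrahedron of two-rebit states with maximally mixed second
marginal and `Core_ℝ = K_ℝ ∩ {½·1 − ρ(x) ≽ 0}` is its central-symmetry core (= the PPT states of the
fibre, route item `FibreReflection`). Value equality `64·vol₇ Core_ℝ = 29·vol₇ K_ℝ` is a theorem of the
tree (`Literature.Probability.RandomMatrix.LovasAndai2017_rebit_fibre_separability_probability_holds`);
the crux is the CHAIN.

## The line (LovasAndai2017 Thm 1, Cor 2, Lemma 6, Thm 2 and App. A, made move-by-move)

Lovas–Andai's computation passes through three intermediate integrals. The skeleton TYPES each of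
them as an explicit rational integral representation and each passage as one stub; the assembly is
transitivity of `KZ.Equivalent`.

* `F_C`, `F_K` — dimension 7, coordinates `y = (a, b, p, z₀, z₁, z₂, z₃)`; domains
  `fibredCoreDomain`, `fibredKDomain`, integrand `fibredIntegrand c`, `c = 64, 29`.
  The SCHUR–EIGENVALUE FIBRATION of the two bodies: `X = R_θ diag(a, b) R_θᵀ` with
  `0 < b < a < ½` and `p = tan(θ/2) ∈ (0, ∞)` (rational rotation cells), and
  `Z = X^{1/2} (R_θ C R_θᵀ) (½ − X)^{1/2}` with `C ↔ z` in the operator-norm ball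
  `B_ℝ = {Σ zᵢ² ≤ 2, 1 − Σ zᵢ² + det² ≥ 0}` for `K_ℝ`, resp. in `B_ℝ ∩ V_ε B_ℝ V_ε⁻¹` for `Core_ℝ`,
  where `ε(a,b)² = b(½ − a)/(a(½ − b)) < 1` is the ratio of the eigenvalues of `X(½ − X)⁻¹`
  (`½·1 − ρ ≽ 0 ⟺ ‖W C W⁻¹‖ ≤ 1`, `W = (X(½−X)⁻¹)^{1/2}`; LovasAndai2017 Thm 1/Cor 1 at `D = ½·1`).
  The conjugate-ball condition is written polynomially (`× D²`, `ε² = N/D`, `N = epsNum`,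
  `D = epsDen`) in exactly the convention of route item `DefectLogRebit`.
  Jacobian of the whole substitution: `(a − b) · ab(½ − a)(½ − b) · 2/(1 + p²)`
  (Vandermonde × Schur `det X · det(½ − X)` × `dθ = 2 dp/(1 + p²)`) = `triWeight a b · 2/(1+p²)`.
* `R_ε` — dimension 5, coordinates `(a, b, p, s, u)`, domain `defectDomain`, integrand
  `defectIntegrand (64/3)`: the core fibre `B_ℝ ∩ V_ε B_ℝ V_ε⁻¹` (4 real dimensions, volume `χ₁(ε)`)
  replaced by Lovas–Andai's Lemma-6 representation of `3χ₁(ε)`,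
  `[{0 < u < s < ε}, 8((s² + 1)/s³ − (s² − 1)²/(s³(1 − u²)))]` (`log((1+s)/(1−s)) = ∫₀ˢ 2du/(1−u²)`
  unfolded; verbatim the right-hand side of route item `DefectLogRebit`), UNIFORMLY in the algebraic
  parameter `ε(a, b)` (`s < ε(a,b)` ⟺ `s²·D < N`).
* `R₁` — the same with `ε = 1` (domain `defectOneDomain`) and weight `29/3`.

Stubs (each a genuine lemma of the line; sizes are guesses):

1. `stub_coreFibration` (M/L): `[Core_ℝ, 64] ~ F_C` — one change of variables (rule 2) on the
   full-measure cell `{a > b, θ ∈ (0, π), X ≻ 0, ½ − X ≻ 0}` plus rule 1a for the null complement;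
   the map is `ℚ`-semialgebraic (square roots of `2 × 2` PSD matrices, rational rotation).
2. `stub_parametricDefect` (L): `F_C ~ R_ε` — Lovas–Andai Lemma 6 / App. A (route item
   `DefectLogRebit`, dimension 4 → 2 for each fixed rational `ε`) run as a FIBRED chain over the
   eigenvalue triangle, the parameter `ε(a,b)` being an algebraic function of the base
   (`KZ.fibredRelations` vocabulary of `Literature/…/KZFibredRelations.lean`).
3. `stub_closingIdentity` (L/XL, LOAD-BEARING): `R_ε ~ R₁` — Lovas–Andai's closing computation
   (Thm 2, p. 8: `u = (1−x)/(1+x)`, `(u, v) ↦ (ts, s/t)`, one integration by parts, and the weight-2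
   cancellation `(64/3)∫₀¹ R(t) χ̃₁′(t) dt = 1/4` whose printed primitive is dilogarithmic) as a chain
   between two RATIONAL 5-dimensional representations. Its value identity is, after the common
   factor `π = ∫₀^∞ 2dp/(1+p²)` and Lemma 6, literally the tree's
   `Literature.Probability.RandomMatrix.LovasAndai.eigenPair_identity`
   (`64 ∫∫_{b<a} w χ₁(ε(a,b)) = 29 ∫∫_{b<a} w χ₁(1)`).
4. `stub_kNormalForm` (M): `[K_ℝ, 29] ~ R₁` — the fibration of `K_ℝ` (as in stub 1, with the full
   ball as fibre: `F_K = [triangle × angle, 29·w·2/(1+p²)] ⋆ [B_ℝ, 1]`, a product in the layout of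
   `KZ.IntegralRep.prod`) followed by `DefectLogRebit` at `ε = 1` on the fibre via
   `KZ.Equivalent.prod` (KZProductIdeal, proved).

Assembly: `assembly_of_legs` (hypothetical form: the four stub statements imply the crux; `r ~ m ~ q ~ q₁`
by stubs 1–3, each producing its target representation, and `r' ~ q₁` by stub 4, universal in both
representations; closed by `trans`/`symm`, no sorry, standard axioms) and `RebitCore2964_of` (the crux
BY NAME from the declared stubs `stub_*` through `assembly_of_legs`; no sorry of its own).

## Value audit (planner, folder `num/`, 2026-08-17)

`vol₇ K_ℝ = χ₁(1) · ∫_{0≺X≺½} det X det(½−X) dX = (2π²/3)(π/35840) = π³/53760 = 5.7675e-4`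
(quadrature of the X-integral: 8.76562e-5 = π/35840 ✓; Monte Carlo of the typed set, 4·10⁶ points:
5.724e-4 ± 0.042e-4 ✓); `vol₇ Core_ℝ`: MC 2.588e-4 ± 0.028e-4 vs `29π³/(64·53760)` = 2.613e-4 ✓;
`3χ₁(1) = ∫₀¹ 8(s + 1/s − ½(s − 1/s)² log((1+s)/(1−s))) ds/s` = 19.73921 = 2π² ✓ (so `lemma6Integrand`
integrates to `3χ₁(ε)` over `{0<u<s<ε}`); eigen-pair identity by 2-dim quadrature:
`∫∫ w χ₁(ε) / ∫∫ w χ₁(1)` = 0.45304 vs 29/64 = 0.453125 ✓. Hence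
`value F_C = value R_ε = 64π ∫∫ w χ₁(ε) = 29π ∫∫ w χ₁(1) = value R₁ = value F_K = 29 vol₇ K_ℝ = 64 vol₇ Core_ℝ`:
every stub is an equal-value pair (no stub is false by value). Integrability of `defectIntegrand`:
`lemma6Integrand = O(1/s)` on `{u < s}` near `s = 0` (fibre length `s`), `(s²−1)²/(1−u²)` has an
integrable logarithmic endpoint at `s → 1`; all other factors bounded — the intermediate
representations exist.

## Disproof used / negatives / barriers

No `Disproof.lean` is on file for this crux (`ledger crux ls stmt-KontsevichZagierPeriods-9265`: no
workfiles, 2026-08-17), so no `_false_without_` obstruction constrains the stubs; the negatives index of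
the summit has one entry (`KinematicPlaneConvex`, kinematic-measure convexity), unrelated to these bodies.
Barrier `Literature.Barriers.KontsevichZagierPeriods.noSemialgebraicPrimitive_inv_sub_two` is honoured:
the logarithm of Lemma 6 rides as the extra variable `u` in `R_ε`, `R₁` (rational integrand
`lemma6Integrand`), and stub 3 is free to add further variables for `log t`, `log((1+t)/(1−t))`; no
stub asserts a semialgebraic primitive of `1/(1−u²)` or `1/s`. `cressonViuSos_prop_3_2` (no global
scissors-free map between bodies of different symmetry) is respected: stubs 1 and 4 dissect first
(rotation cells, null sets) and map fibrations, not the bodies onto each other.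
-/

noncomputable section

namespace Summit.KontsevichZagierPeriods.KontsevichZagierPeriods.Cruxes.RebitCore2964.Birth

set_option linter.dupNamespace false

open Set
open scoped Matrix
open Literature.NumberTheory.Transcendental

/-! ### The intermediate representations (explicit rational data) -/

/-- The eigenvalue-triangle weight `w(a,b) = (a − b) · ab · (½ − a)(½ − b)`: the Vandermonde factor of
the `2 × 2` symmetric eigen-decomposition times the Schur Jacobian `det X · det(½·1 − X)` for
`X ~ diag(a, b)`. [cite: LovasAndai2017, Theorem 1 and proof of Theorem 2] -/
def triWeight (a b : ℝ) : ℝ := (a - b) * (a * b) * ((1 / 2 - a) * (1 / 2 - b))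

/-- Numerator `N = b(½ − a)` of `ε(a,b)² = N/D`, the ratio of the eigenvalues of `X(½·1 − X)⁻¹`
(`0 < b < a < ½`, so `0 < N < D`). [cite: LovasAndai2017, Corollary 1–2] -/
def epsNum (a b : ℝ) : ℝ := b * (1 / 2 - a)

/-- Denominator `D = a(½ − b)` of `ε(a,b)² = N/D`. [cite: LovasAndai2017, Corollary 1–2] -/
def epsDen (a b : ℝ) : ℝ := a * (1 / 2 - b)

/-- Domain of `F_K` (dimension 7, `y = (a, b, p, z₀, z₁, z₂, z₃)`): eigenvalue triangle
`0 < b < a < ½`, rotation parameter `p = tan(θ/2) > 0`, and `z` in the operator-norm unit ball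
`B_ℝ` of `ℝ^{2×2}` written polynomially as in route item `DefectLogRebit`
(`Σ zᵢ² ≤ 2 ∧ 0 ≤ 1 − Σ zᵢ² + (z₀z₃ − z₁z₂)²`). First three coordinates = base, last four = fibre
(the layout of `KZ.IntegralRep.prod`). [cite: LovasAndai2017, Theorem 1] -/
def fibredKDomain : Set (Fin 7 → ℝ) :=
  {y | (0 < y 1 ∧ y 1 < y 0 ∧ y 0 < 1 / 2) ∧ 0 < y 2 ∧
    (y 3 ^ 2 + y 4 ^ 2 + y 5 ^ 2 + y 6 ^ 2 ≤ 2 ∧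
      0 ≤ 1 - (y 3 ^ 2 + y 4 ^ 2 + y 5 ^ 2 + y 6 ^ 2) + (y 3 * y 6 - y 4 * y 5) ^ 2)}

/-- Domain of `F_C`: the part of `fibredKDomain` whose fibre coordinate `z` also lies in the conjugate
ball `V_ε B_ℝ V_ε⁻¹`, `ε = ε(a,b)`, i.e. the `DefectLogRebit` condition
`ε²z₀² + ε⁴z₁² + z₂² + ε²z₃² ≤ 2ε² ∧ 0 ≤ ε² − (…) + ε²(z₀z₃ − z₁z₂)²` multiplied through by `D²`
(`ε² = N/D`, `D > 0` on the triangle). [cite: LovasAndai2017, Corollary 1 and Lemma 6] -/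
def fibredCoreDomain : Set (Fin 7 → ℝ) :=
  {y | y ∈ fibredKDomain ∧
    (epsNum (y 0) (y 1) * epsDen (y 0) (y 1) * y 3 ^ 2 + epsNum (y 0) (y 1) ^ 2 * y 4 ^ 2 +
          epsDen (y 0) (y 1) ^ 2 * y 5 ^ 2 + epsNum (y 0) (y 1) * epsDen (y 0) (y 1) * y 6 ^ 2 ≤
        2 * (epsNum (y 0) (y 1) * epsDen (y 0) (y 1)) ∧
      0 ≤ epsNum (y 0) (y 1) * epsDen (y 0) (y 1) -
          (epsNum (y 0) (y 1) * epsDen (y 0) (y 1) * y 3 ^ 2 + epsNum (y 0) (y 1) ^ 2 * y 4 ^ 2 +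
            epsDen (y 0) (y 1) ^ 2 * y 5 ^ 2 + epsNum (y 0) (y 1) * epsDen (y 0) (y 1) * y 6 ^ 2) +
        epsNum (y 0) (y 1) * epsDen (y 0) (y 1) * (y 3 * y 6 - y 4 * y 5) ^ 2)}

/-- Integrand of `F_C` (`c = 64`) and `F_K` (`c = 29`): the constant times the fibration Jacobian
`w(a,b) · 2/(1 + p²)` (the angular factor `dθ = 2dp/(1+p²)` is a spectator on both sides of every
stub and is never integrated out). [cite: LovasAndai2017, Theorem 1] -/
def fibredIntegrand (c : ℝ) : (Fin 7 → ℝ) → ℝ :=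
  fun y => c * triWeight (y 0) (y 1) * (2 / (1 + y 2 ^ 2))

/-- Lovas–Andai's Lemma-6 integrand with the logarithm unfolded:
`g(s,u) = 8((s² + 1)/s³ − (s² − 1)²/(s³(1 − u²)))`, so that
`∫₀ˢ g(s,u) du = 8(s + 1/s − ½(s − 1/s)² log((1+s)/(1−s)))/s = 3χ₁′(s)` and
`∫∫_{0<u<s<ε} g = 3χ₁(ε)` (`χ₁(1) = 2π²/3`); verbatim the integrand of route item `DefectLogRebit`.
[cite: LovasAndai2017, Lemma 6 and Table 2] -/
def lemma6Integrand (s u : ℝ) : ℝ :=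
  8 * ((s ^ 2 + 1) / s ^ 3 - (s ^ 2 - 1) ^ 2 / (s ^ 3 * (1 - u ^ 2)))

/-- Domain of `R_ε` (dimension 5, `y = (a, b, p, s, u)`): triangle, angle, and the Lemma-6 fibre
`0 < u < s < ε(a,b)`, the last inequality written polynomially as `s² · D < N`.
[cite: LovasAndai2017, Lemma 6 and proof of Theorem 2] -/
def defectDomain : Set (Fin 5 → ℝ) :=
  {y | (0 < y 1 ∧ y 1 < y 0 ∧ y 0 < 1 / 2) ∧ 0 < y 2 ∧
    (0 < y 4 ∧ y 4 < y 3 ∧ y 3 ^ 2 * epsDen (y 0) (y 1) < epsNum (y 0) (y 1))}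

/-- Domain of `R₁`: as `defectDomain` with `ε = 1` (`0 < u < s < 1`), a product
`(triangle × angle) × {0 < u < s < 1}`. [cite: LovasAndai2017, Lemma 6 and proof of Theorem 2] -/
def defectOneDomain : Set (Fin 5 → ℝ) :=
  {y | (0 < y 1 ∧ y 1 < y 0 ∧ y 0 < 1 / 2) ∧ 0 < y 2 ∧ (0 < y 4 ∧ y 4 < y 3 ∧ y 3 < 1)}

/-- Integrand of `R_ε` (`c = 64/3`) and `R₁` (`c = 29/3`): `c · w(a,b) · 2/(1+p²) · g(s,u)`; rational,
with denominators `(1 + p²) s³ (1 − u²) ≠ 0` on both domains (`0 < u < s < 1`).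
[cite: LovasAndai2017, proof of Theorem 2] -/
def defectIntegrand (c : ℝ) : (Fin 5 → ℝ) → ℝ :=
  fun y => c * triWeight (y 0) (y 1) * (2 / (1 + y 2 ^ 2)) * lemma6Integrand (y 3) (y 4)

/-! ### The stubs -/

/-- **Stub 1 — Schur–eigenvalue fibration of the core.** Every representation `[Core_ℝ, 64]` is
KZ-equivalent to a representation `F_C = [fibredCoreDomain, 64 · w(a,b) · 2/(1+p²)]`: the substitution
`(a, b, p, C) ↦ x` (`X = R_θ diag(a,b) R_θᵀ`, `p = tan(θ/2)`, `Z = X^{1/2}(R_θ C R_θᵀ)(½−X)^{1/2}`) is a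
`ℚ`-semialgebraic bijection from the open cell of `fibredCoreDomain` onto a full-measure subset of
`Core_ℝ` with Jacobian `w(a,b)·2/(1+p²)` (rule 2), the core condition `½·1 − ρ ≽ 0` becoming
`‖V_ε C V_ε⁻¹‖ ≤ 1` on the fibre (LovasAndai2017 Thm 1 / Cor 1 at `D = ½·1`); null sets by rule 1a.
Why plausibly true: it is the measure-theoretic reduction already proved in the tree
(`TwoQubitSeparabilityVolumesRebitFibreReduction.lean`) redone as ONE change of variables with
semialgebraic data. Size M/L (semialgebraicity of `X^{1/2}`, `InjOn`, `HasFDerivWithinAt`, the 7×7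
Jacobian). [cite: LovasAndai2017, Theorem 1 and Corollary 1] -/
theorem stub_coreFibration :
    ∀ (ρ : (Fin 7 → ℝ) → Matrix (Fin 4) (Fin 4) ℝ),
      (∀ x, ρ x = !![x 0, x 2, x 3, x 4; x 2, x 1, x 5, x 6; x 3, x 5, 1 / 2 - x 0, -x 2;
        x 4, x 6, -x 2, 1 / 2 - x 1]) →
      ∀ r : KZ.IntegralRep 7,
        r.domain = {x | (ρ x).PosSemidef ∧
          ((2 : ℝ)⁻¹ • (1 : Matrix (Fin 4) (Fin 4) ℝ) - ρ x).PosSemidef} →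
        Set.EqOn r.integrand (fun _ => 64) r.domain →
        ∃ m : KZ.IntegralRep 7, m.domain = fibredCoreDomain ∧
          Set.EqOn m.integrand (fibredIntegrand 64) fibredCoreDomain ∧ KZ.Equivalent r m := by
  sorry

/-- **Stub 2 — the parametric defect (Lovas–Andai Lemma 6 as a fibred chain).** Every representation
`F_C` is KZ-equivalent to a representation `R_ε = [defectDomain, (64/3) · w · 2/(1+p²) · g(s,u)]`:
over each point `(a, b, p)` of the base the 4-dimensional fibre `B_ℝ ∩ V_ε B_ℝ V_ε⁻¹` (volume
`χ₁(ε)`, `ε = ε(a,b)`) is traded for the 2-dimensional Lemma-6 fibre `{0 < u < s < ε}` with integrand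
`g` (value `3χ₁(ε)`, whence the weight `64/3`) — the chain of route item `DefectLogRebit`
(LovasAndai2017 App. A: hyperbolic atlas `X = rY±(t, ρ, φ)`, `w = eᵗ`, `tan(φ/2)`, the conjugation
as the scaling `w ↦ εw`, volume form `r³`, cell split at `t = δ/2`) run UNIFORMLY in the algebraic
parameter `ε(a,b)`, every move being fibred over the base (`KZ.fibredRelations`).
Why it might fail: only as a chain — a step of App. A that is a move for each rational `ε` but whose
data are not semialgebraic jointly in `(a, b, z)`; none is visible (all cells are polynomial in `ε²
= N/D`). Size L. [cite: LovasAndai2017, Lemma 6 and Appendix A] -/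
theorem stub_parametricDefect :
    ∀ m : KZ.IntegralRep 7, m.domain = fibredCoreDomain →
      Set.EqOn m.integrand (fibredIntegrand 64) fibredCoreDomain →
      ∃ q : KZ.IntegralRep 5, q.domain = defectDomain ∧
        Set.EqOn q.integrand (defectIntegrand (64 / 3)) defectDomain ∧ KZ.Equivalent m q := by
  sorry

/-- **Stub 3 — the closing identity (weight-2 cancellation) as a chain; LOAD-BEARING.** Every
representation `R_ε = [defectDomain, (64/3)·w·2/(1+p²)·g]` is KZ-equivalent to a representation
`R₁ = [defectOneDomain, (29/3)·w·2/(1+p²)·g]`. Both are RATIONAL 5-dimensional representations (the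
angle `p` a common spectator), and their value equality is exactly Lovas–Andai's Theorem 2 on the
fibre: `64 ∫∫_{b<a} w(a,b) χ₁(ε(a,b)) da db = 29 ∫∫_{b<a} w χ₁(1)` (tree:
`Literature.Probability.RandomMatrix.LovasAndai.eigenPair_identity`, kernel-checked). The foreseen
chain is LA's p. 8 made of moves: `a = (1+x)/4`, `u_LA = (1−x)/(1+x) = (1−2a)/(2a)` (rational),
`(u_LA, v_LA) ↦ (ts, s/t)` with `t = ε` (rule 2, algebraic), Fubini free, one integration by parts
(rules 1 + 3 with a rational primitive), leaving the one-variable identity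
`(64/3)∫₀¹ R(t) χ̃₁′(t) dt = 1/4`, `R(t) = (11(1−t⁶) + 27t²(1−t²) + 6(1+t²)(1+8t²+t⁴) log t)/(t²−1)⁷`,
whose printed primitive (`Li₂(1−t)`, `Li₂(−t)`, `log t · log(1+t)`, `atanh`) is NOT semialgebraic:
both logarithms must ride as extra variables and the weight-2 cancellation be redone by moves
(Calabi-style involutions for the `π²/6`-type evaluations). Why it might fail: this is the research
content of the crux (barrier `noSemialgebraicPrimitive_inv_sub_two` engaged and evaded only by adding
variables); a forced evaluation of a dilogarithm at an algebraic point with no algebraic-CoV chain would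
stall it. Size L/XL. [cite: LovasAndai2017, Theorem 2 (proof, p. 8)] -/
theorem stub_closingIdentity :
    ∀ q : KZ.IntegralRep 5, q.domain = defectDomain →
      Set.EqOn q.integrand (defectIntegrand (64 / 3)) defectDomain →
      ∃ q₁ : KZ.IntegralRep 5, q₁.domain = defectOneDomain ∧
        Set.EqOn q₁.integrand (defectIntegrand (29 / 3)) defectOneDomain ∧ KZ.Equivalent q q₁ := by
  sorry

/-- **Stub 4 — normal form of the denominator side.** Every representation `[K_ℝ, 29]` is
KZ-equivalent to every representation `R₁ = [defectOneDomain, (29/3)·w·2/(1+p²)·g]`: the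
Schur–eigenvalue fibration of stub 1 with the FULL ball as fibre gives
`[K_ℝ, 29] ~ F_K = [fibredKDomain, 29·w·2/(1+p²)] = [triangle × angle, 29·w·2/(1+p²)] ⋆ [B_ℝ, 1]`
(a product in the coordinate layout of `KZ.IntegralRep.prod`), and route item `DefectLogRebit` at
`ε = 1` (`[B_ℝ, 3] ~ [{0<u<s<1}, g]`, rescaled move by move) multiplied by the base through
`KZ.Equivalent.prod` (KZProductIdeal, proved) gives `F_K ~ R₁`; two representations with the data of
`R₁` are equivalent by integrand additivity. Value: `29 · (π/35840) · (2π²/3) = 29 vol₇ K_ℝ = 29π³/53760`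
on both sides. Why plausibly true: each ingredient is either proved measure-theoretically in the tree or
is the `ε = 1` instance of a typed support item. Size M. [cite: LovasAndai2017, Theorem 1 and Lemma 6] -/
theorem stub_kNormalForm :
    ∀ (ρ : (Fin 7 → ℝ) → Matrix (Fin 4) (Fin 4) ℝ),
      (∀ x, ρ x = !![x 0, x 2, x 3, x 4; x 2, x 1, x 5, x 6; x 3, x 5, 1 / 2 - x 0, -x 2;
        x 4, x 6, -x 2, 1 / 2 - x 1]) →
      ∀ r' : KZ.IntegralRep 7, r'.domain = {x | (ρ x).PosSemidef} →
        Set.EqOn r'.integrand (fun _ => 29) r'.domain →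
        ∀ q₁ : KZ.IntegralRep 5, q₁.domain = defectOneDomain →
          Set.EqOn q₁.integrand (defectIntegrand (29 / 3)) defectOneDomain →
          KZ.Equivalent r' q₁ := by
  sorry

/-! ### Assembly -/

/-- **Assembly of the line, hypothetical form** (kernel-checked, no `sorry`, standard axioms only):
the four stub STATEMENTS give the crux `RebitCore2964` by transitivity and symmetry of
`KZ.Equivalent` — `[Core_ℝ, 64] ~ F_C ~ R_ε ~ R₁ ~ [K_ℝ, 29]`. -/
theorem assembly_of_legs :
    (∀ (ρ : (Fin 7 → ℝ) → Matrix (Fin 4) (Fin 4) ℝ),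
      (∀ x, ρ x = !![x 0, x 2, x 3, x 4; x 2, x 1, x 5, x 6; x 3, x 5, 1 / 2 - x 0, -x 2;
        x 4, x 6, -x 2, 1 / 2 - x 1]) →
      ∀ r : KZ.IntegralRep 7,
        r.domain = {x | (ρ x).PosSemidef ∧
          ((2 : ℝ)⁻¹ • (1 : Matrix (Fin 4) (Fin 4) ℝ) - ρ x).PosSemidef} →
        Set.EqOn r.integrand (fun _ => 64) r.domain →
        ∃ m : KZ.IntegralRep 7, m.domain = fibredCoreDomain ∧
          Set.EqOn m.integrand (fibredIntegrand 64) fibredCoreDomain ∧ KZ.Equivalent r m) →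
    (∀ m : KZ.IntegralRep 7, m.domain = fibredCoreDomain →
      Set.EqOn m.integrand (fibredIntegrand 64) fibredCoreDomain →
      ∃ q : KZ.IntegralRep 5, q.domain = defectDomain ∧
        Set.EqOn q.integrand (defectIntegrand (64 / 3)) defectDomain ∧ KZ.Equivalent m q) →
    (∀ q : KZ.IntegralRep 5, q.domain = defectDomain →
      Set.EqOn q.integrand (defectIntegrand (64 / 3)) defectDomain →
      ∃ q₁ : KZ.IntegralRep 5, q₁.domain = defectOneDomain ∧
        Set.EqOn q₁.integrand (defectIntegrand (29 / 3)) defectOneDomain ∧ KZ.Equivalent q q₁) →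
    (∀ (ρ : (Fin 7 → ℝ) → Matrix (Fin 4) (Fin 4) ℝ),
      (∀ x, ρ x = !![x 0, x 2, x 3, x 4; x 2, x 1, x 5, x 6; x 3, x 5, 1 / 2 - x 0, -x 2;
        x 4, x 6, -x 2, 1 / 2 - x 1]) →
      ∀ r' : KZ.IntegralRep 7, r'.domain = {x | (ρ x).PosSemidef} →
        Set.EqOn r'.integrand (fun _ => 29) r'.domain →
        ∀ q₁ : KZ.IntegralRep 5, q₁.domain = defectOneDomain →
          Set.EqOn q₁.integrand (defectIntegrand (29 / 3)) defectOneDomain →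
          KZ.Equivalent r' q₁) →
    Summit.KontsevichZagierPeriods.KontsevichZagierPeriods.Theses.SpectrahedralScissors.RebitCore2964 := by
  intro h₁ h₂ h₃ h₄ ρ hρ r r' hr hri hr' hri'
  obtain ⟨m, hm, hmi, e₁⟩ := h₁ ρ hρ r hr hri
  obtain ⟨q, hq, hqi, e₂⟩ := h₂ m hm hmi
  obtain ⟨q₁, hq₁, hq₁i, e₃⟩ := h₃ q hq hqi
  exact ((e₁.trans e₂).trans e₃).trans (h₄ ρ hρ r' hr' hri' q₁ hq₁ hq₁i).symm

/-- **THE SKELETON THEOREM.** The crux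
`Summit.KontsevichZagierPeriods.KontsevichZagierPeriods.Theses.SpectrahedralScissors.RebitCore2964`
concluded BY NAME from the four declared stubs through `assembly_of_legs`; it becomes the closing
theorem of item stmt-KontsevichZagierPeriods-9265 once `stub_coreFibration`, `stub_parametricDefect`,
`stub_closingIdentity` and `stub_kNormalForm` are discharged (it contains no `sorry` of its own). -/
theorem RebitCore2964_of :
    Summit.KontsevichZagierPeriods.KontsevichZagierPeriods.Theses.SpectrahedralScissors.RebitCore2964 :=
  assembly_of_legs stub_coreFibration stub_parametricDefect stub_closingIdentity stub_kNormalForm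

end Summit.KontsevichZagierPeriods.KontsevichZagierPeriods.Cruxes.RebitCore2964.Birth

end
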